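import Summits.QuantumFields.BalabanUV.T4Continuum.Support.NE3SmoothRightInverseW
import Summits.QuantumFields.BalabanUV.T4Continuum.Support.NE3CovariantTentInterpolantEnergy
import Summits.QuantumFields.BalabanUV.T4Continuum.Support.NE3TowerBondVsSegment
import Summits.QuantumFields.BalabanUV.T4Continuum.Support.AveragingDeficitCounting
import HarnessLib

/-!
# T⁴ programme, node NE3 — route Π, row Π-R (curved step), file Π-R-W6a: THE SUP LETTER (R5) OF THE EXACT CURVED RIGHT INVERSE —
# `‖rightInvW … φ (y,μ)‖ ≤ supC(d,L) ∕ (M·(1 − θ)) · ‖φ‖_∞`, `M = L^{k+1}`, k-FREE, N-FREE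

NE3 (node U1b) formalisation swarm, leaf seat `b2b-balaban-t4-ne3-formalise-leaf-01` (gen 8); re-planned row Π-R-W (FINDING F-ne3leaf01g8-1,
`HOME/CLAIMS.log` 2026-08-20 ≈23:04Z); letter (R5) of ruling ρ-g25-1 (2) for W5's `rightInvW` (`NE3SmoothRightInverseW`, `D_W R_W φ = φ` exact).
THE THREE SIZES.  (i) the transported lift `‖covLift M W Φ (y,μ)‖ = ‖smoothLift M Φ (y,μ)‖ ≤ liftC∕M·‖Φ‖_∞` (W3 isometry + Π-R♭-4a);
(ii) **the accumulated frame generator is O(1)**: `‖framePotW L (k+1) W Y z‖ ≤ frameC(d,L)·M·‖Y‖_∞` (`NE3FramePotBoundW.framePotW_eq_sum` +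
`norm_Fbar_le` + the global sup tower `norm_QbarIter_le_two_mul_of_sup` + `Σ_{m<k+1} L^m ≤ L^{k+1}`), so `G = O(frameC·liftC·‖Φ‖_∞)`;
(iii) **the covariant corrector is O(|G|∕M) on EVERY bond** — gen-6's `NE3CovariantTentInterpolantEnergy.normSq_gaugeDir_tinterpW_le` with the
coarse field `U = cavgIter L (k+1) W` (`‖U − bseg‖ ≤ 8·loopRad(x_k)`, NE3-R2's `norm_cavgIter_sub_bseg_le_top`) gives
`‖gaugeDir W (tinterpW M W (−G)) (y,α)‖ ≤ corrC(d)∕M · sup|G|` under the regime letter `(L^{k+1})²·x ≤ 1` (no face-bond loss: FINDING (b)).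
With W5's `norm_solveW_le` (`‖Φ‖_∞ ≤ ‖φ‖_∞∕(1−θ)`): **`norm_rightInvW_le`**.

CONTENT ([folklore]; 0 sorry; DATA defs `frameC`, `corrC`, `supC` — explicit): §1 the global sup tower; §2 the sup bound of the accumulated frames;
§3a the tent coefficient letter `kt_mul_sq_le` (DATA def `ktC`); §3 the pointwise corrector bound; §4 **`norm_rightInvW_le`** (R5, global sup form — the solve is global, so no local form is claimed).

HONEST FRAMING.  Kinematics of OUR objects; constants explicit and crude; (R1)–(R4), (R6′) remain (W6b–d); nothing about minimisers; (P♮)_W, T-E_w and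
**NE3 are NOT proved**; spine PROVED 0∕9; finite T⁴ rung (B)+1 — NOT infinite volume, NOT mass gap, NOT `BetaPertH`, NOT Clay.  PLACEMENT:
`Summits/QuantumFields/BalabanUV/`.  HONEST DEPENDENCY (cell page 1): continuum YM on T⁴ ⇐ BetaPertH ∧ nine spine estimates (0/9 proved); BetaPertH ⇐ (D1)
∧ (D4) ∧ CAP+tail; G-an2-4 gates asym, D1 and NE2/3/4.
-/

set_option autoImplicit false

open scoped BigOperators Matrix.Norms.L2Operator
open Finset

namespace Summit.QuantumFields.BalabanUV.T4Continuum.NE3RightInverseSupLetters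

open Literature.MathematicalPhysics.QuantumFieldTheory.Balaban1983to89
open B7Prop1Explicit B7Prop2Explicit
open T4AveragingDeficitWall (IsUnitaryCfg IsSkewDir SmallField Ad dirL1 box)
open T4AveragingDeficitWallBoundary (IsPeriodicCfg)
open AveragingDeficitPeriodicCounting (IsPeriodicDir)
open AveragingDeficitTransport (norm_Ad_of_unitary)
open AveragingDeficitChartCalculus (cavg)
open AveragingDeficitMultiLevelPrep (cavgIter LevelSmall prop1Radius_nonneg cavgIter_unitary_small)
open AveragingDeficitTwoLevelPrep (prop1Radius)
open AveragingDeficitTorusChart (TDir extDir resDir redN)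
open AveragingDeficitTwoLevelPrep (skewSub)
open AveragingDeficitBlockDensity (bseg)
open AveragingDeficitCounting (card_box_eq)
open SpreadLift (loopRad)
open BlockAveragePushDirGauge (gaugeDir)
open NE3TangentCovariantStructure (Qbar Fbar)
open NE3TangentCovariantTower (QbarIter framePotW step_small)
open NE3CovariantTentInterpolant (tinterpW)
open NE3CovariantTentInterpolantEnergy (normSq_gaugeDir_tinterpW_le)
open NE3TowerBondVsSegment (norm_cavgIter_sub_bseg_le_top)
open NE3TopRadiusLetters (loopRad_iterate_le_of_levelSmall radIter_eq_iterate)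
open NE3SmoothLiftFlat (smoothLift)
open NE3SmoothLiftBounds (norm_smoothLift_le)
open NE3CovariantLineSumsError (wC wC_nonneg)
open NE3FramePotBoundW (framePotW_eq_sum norm_Fbar_le)
open NE3CovariantLift (covLift hatInvW frameGen norm_covLift_eq)
open NE3QbarNearFlat (norm_Qbar_le_sup)
open NE3QbarIterNearFlat (prod_add_le_two_mul_pow sum_wC_eq_Ssum)
open NE3QbarIterCovLiftPrep (liftC cruxC liftC_nonneg class_at_level sum_pow_le_pow_real)
open NE3SmoothRightInverseW (solveW resSkew rightInvW norm_solveW_le)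

noncomputable section

variable {d : ℕ} {n : Type*} [Fintype n] [DecidableEq n]

/-! ## §1 The global sup tower -/

/-- **GLOBAL SUP TOWER (exact product form)**: `‖QbarIter L i W Y‖_∞ ≤ ‖Y‖_∞·Π_{i'<i}(L + wC(x_{i'}))` for `i ≤ k+1`. [folklore] -/
theorem norm_QbarIter_le_prod_of_sup [Nonempty n] {L : ℕ} (hL : 1 ≤ L) (k : ℕ) :
    ∀ {W : Site d → Fin d → (Matrix n n ℂ)ˣ} {x : ℝ}, IsUnitaryCfg W → 0 ≤ x → LevelSmall d L k x → SmallField W x →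
    ∀ (Y : Site d → Fin d → Matrix n n ℂ) {s : ℝ}, (∀ (x' : Site d) (μ : Fin d), ‖Y x' μ‖ ≤ s) →
    ∀ (i : ℕ), i ≤ k + 1 → ∀ (y : Site d) (μ : Fin d),
      ‖QbarIter L i W Y y μ‖ ≤ s * ∏ i' ∈ Finset.range i, ((L : ℝ) + wC d L ((prop1Radius d L)^[i'] x)) := by
  induction k with
  | zero =>
      intro W x hWu hx hs hWx Y s hY i hi y μ
      obtain ⟨h512, -, -, -⟩ := step_small hL hWu hx hs hWx
      rcases i with _ | i
      · simp only [Finset.range_zero, Finset.prod_empty, mul_one]; exact hY y μ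
      · have hi0 : i = 0 := by omega
        subst hi0
        simp only [zero_add, Finset.range_one, Finset.prod_singleton, Function.iterate_zero, id_eq]
        have h := norm_Qbar_le_sup hL hWu hx h512 hWx y μ Y (fun x' ν _ => hY x' ν)
        have hwC : wC d L x = loopRad d L x * (1250 * (((BlockAverageVaryHolo.nbRad d L : ℕ) : ℝ) + L) + 8 * (d * L) + 2 * L) := by
          unfold wC loopRad NE3CovariantLineSumsError.Csup; ring
        rw [mul_comm, hwC]; exact h
  | succ k ih =>
      intro W x hWu hx hs hWx Y s hY i hi y μ
      obtain ⟨h512, hW₁u, hr0, hW₁x⟩ := step_small hL hWu hx hs.1 hWx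
      rcases i with _ | i
      · simp only [Finset.range_zero, Finset.prod_empty, mul_one]; exact hY y μ
      · have hY₁ : ∀ (x' : Site d) (μ : Fin d), ‖Qbar L W Y x' μ‖ ≤ ((L : ℝ) + wC d L x) * s := by
          intro x' ν
          have h := norm_Qbar_le_sup hL hWu hx h512 hWx x' ν Y (fun x'' ν' _ => hY x'' ν')
          have hwC : wC d L x = loopRad d L x * (1250 * (((BlockAverageVaryHolo.nbRad d L : ℕ) : ℝ) + L) + 8 * (d * L) + 2 * L) := by
            unfold wC loopRad NE3CovariantLineSumsError.Csup; ring
          rw [hwC]; exact h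
        have h := ih hW₁u hr0 hs.2 hW₁x (Qbar L W Y) hY₁ i (by omega) y μ
        show ‖QbarIter L i (cavg L W) (Qbar L W Y) y μ‖ ≤ _
        refine h.trans (le_of_eq ?_)
        rw [Finset.prod_range_succ' (fun i' => (L : ℝ) + wC d L ((prop1Radius d L)^[i'] x))]
        simp only [Function.iterate_succ_apply, Function.iterate_zero, id_eq]
        ring

/-- **GLOBAL SUP TOWER IN THE CLASS** (`L ≥ 2`): `‖QbarIter L i W Y‖_∞ ≤ 2·L^i·‖Y‖_∞` for `i ≤ k+1` (leaf-04's `Ssum_le_one`). [folklore] -/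
theorem norm_QbarIter_le_two_mul_of_sup [Nonempty n] {L : ℕ} (hL : 2 ≤ L) (k : ℕ) {W : Site d → Fin d → (Matrix n n ℂ)ˣ} {x : ℝ}
    (hWu : IsUnitaryCfg W) (hx : 0 ≤ x) (hs : LevelSmall d L k x) (hWx : SmallField W x) (Y : Site d → Fin d → Matrix n n ℂ) {s : ℝ}
    (hs0 : 0 ≤ s) (hY : ∀ (x' : Site d) (μ : Fin d), ‖Y x' μ‖ ≤ s) (i : ℕ) (hi : i ≤ k + 1) (y : Site d) (μ : Fin d) :
    ‖QbarIter L i W Y y μ‖ ≤ 2 * (L : ℝ) ^ i * s := by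
  have h := norm_QbarIter_le_prod_of_sup (by omega) k hWu hx hs hWx Y hY i hi y μ
  have hS : (∑ i' ∈ Finset.range i, wC d L ((prop1Radius d L)^[i'] x)) ≤ (L : ℝ) / 2 := by
    have hmono : (∑ i' ∈ Finset.range i, wC d L ((prop1Radius d L)^[i'] x)) ≤ ∑ i' ∈ Finset.range (k + 1), wC d L ((prop1Radius d L)^[i'] x) :=
      Finset.sum_le_sum_of_subset_of_nonneg (Finset.range_mono (by omega))
        fun i' _ _ => wC_nonneg d L (NE3CovariantLineSumsError.iterate_prop1Radius_nonneg (d := d) i' hx)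
    have hfull : (∑ i' ∈ Finset.range (k + 1), wC d L ((prop1Radius d L)^[i'] x)) ≤ 1 := by
      rw [sum_wC_eq_Ssum]
      obtain ⟨h1, h2⟩ := NE3CovariantLineSumsError.Ssum_le_one (d := d) hL hx hs
      exact h1.trans h2
    have hL2 : (2 : ℝ) ≤ L := by exact_mod_cast hL
    linarith
  have hp := prod_add_le_two_mul_pow (by omega) (fun i' => wC d L ((prop1Radius d L)^[i'] x))
    (fun i' => wC_nonneg d L (NE3CovariantLineSumsError.iterate_prop1Radius_nonneg (d := d) i' hx)) i hS
  calc ‖QbarIter L i W Y y μ‖ ≤ s * ∏ i' ∈ Finset.range i, ((L : ℝ) + wC d L ((prop1Radius d L)^[i'] x)) := h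
    _ ≤ s * (2 * (L : ℝ) ^ i) := mul_le_mul_of_nonneg_left hp hs0
    _ = 2 * (L : ℝ) ^ i * s := by ring

/-! ## §2 The accumulated frame generator is `O(M·‖Y‖_∞)` -/

/-- THE FRAME CONSTANT: `frameC = 2·d²·L·(2dL + 1)^d`. [folklore] -/
def frameC (d L : ℕ) : ℝ := 2 * (d : ℝ) ^ 2 * L * (2 * ((d : ℝ) * L) + 1) ^ d

/-- `dirL1` on a sup-box against the sup: `dirL1 V (box R c) ≤ (2R+1)^d·d·s`. [folklore] -/
theorem dirL1_box_le_of_sup (V : Site d → Fin d → Matrix n n ℂ) (R : ℕ) (c : Site d) {s : ℝ} (hV : ∀ (x : Site d) (μ : Fin d), ‖V x μ‖ ≤ s) :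
    dirL1 V (box R c) ≤ ((2 * R + 1 : ℕ) : ℝ) ^ d * (d * s) := by
  unfold dirL1
  calc ∑ x ∈ box R c, ∑ κ : Fin d, ‖V x κ‖ ≤ ∑ _x ∈ box R c, ∑ _κ : Fin d, s :=
        Finset.sum_le_sum fun x _ => Finset.sum_le_sum fun κ _ => hV x κ
    _ = ((2 * R + 1 : ℕ) : ℝ) ^ d * (d * s) := by
        rw [Finset.sum_const, Finset.sum_const, Finset.card_univ, Fintype.card_fin, card_box_eq, nsmul_eq_mul, nsmul_eq_mul]; push_cast; ring

/-- **THE ACCUMULATED FRAMES OF A SUP-BOUNDED DIRECTION** (`L ≥ 2`, class): `‖framePotW L (k+1) W Y z‖ ≤ frameC·L^{k+1}·‖Y‖_∞`. [folklore] -/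
theorem norm_framePotW_le_of_sup [Nonempty n] {L : ℕ} (hL : 2 ≤ L) (k : ℕ) {W : Site d → Fin d → (Matrix n n ℂ)ˣ} {x : ℝ}
    (hWu : IsUnitaryCfg W) (hx : 0 ≤ x) (hs : LevelSmall d L k x) (hWx : SmallField W x) (Y : Site d → Fin d → Matrix n n ℂ) {s : ℝ}
    (hs0 : 0 ≤ s) (hY : ∀ (x' : Site d) (μ : Fin d), ‖Y x' μ‖ ≤ s) (z : Site d) :
    ‖framePotW L (k + 1) W Y z‖ ≤ frameC d L * (L : ℝ) ^ (k + 1) * s := by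
  have hL1 : 1 ≤ L := by omega
  rw [framePotW_eq_sum]
  have hterm : ∀ m ∈ Finset.range (k + 1), ‖Fbar L (cavgIter L m W) (QbarIter L m W Y) (((L : ℤ) ^ (k + 1 - 1 - m)) • z)‖
      ≤ (d * L : ℝ) * (((2 * (d * L) + 1 : ℕ) : ℝ) ^ d * (d * (2 * (L : ℝ) ^ m * s))) := by
    intro m hm
    have hmk : m ≤ k := Nat.lt_succ_iff.mp (Finset.mem_range.mp hm)
    obtain ⟨hu, -, -, -⟩ := class_at_level hL1 hWu hx hs hWx m hmk
    refine (norm_Fbar_le hL1 hu _ _).trans (mul_le_mul_of_nonneg_left ?_ (by positivity))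
    exact dirL1_box_le_of_sup _ _ _ fun x' μ => norm_QbarIter_le_two_mul_of_sup hL k hWu hx hs hWx Y hs0 hY m (by omega) x' μ
  refine (norm_sum_le _ _).trans ((Finset.sum_le_sum hterm).trans ?_)
  have hgeo := sum_pow_le_pow_real hL (k + 1)
  have hc : (0 : ℝ) ≤ (d * L : ℝ) * (((2 * (d * L) + 1 : ℕ) : ℝ) ^ d * (d * (2 * s))) := by positivity
  calc ∑ m ∈ Finset.range (k + 1), (d * L : ℝ) * (((2 * (d * L) + 1 : ℕ) : ℝ) ^ d * (d * (2 * (L : ℝ) ^ m * s)))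
      = (d * L : ℝ) * (((2 * (d * L) + 1 : ℕ) : ℝ) ^ d * (d * (2 * s))) * ∑ m ∈ Finset.range (k + 1), (L : ℝ) ^ m := by
        rw [Finset.mul_sum]; exact Finset.sum_congr rfl fun m _ => by ring
    _ ≤ (d * L : ℝ) * (((2 * (d * L) + 1 : ℕ) : ℝ) ^ d * (d * (2 * s))) * (L : ℝ) ^ (k + 1) := mul_le_mul_of_nonneg_left hgeo hc
    _ = frameC d L * (L : ℝ) ^ (k + 1) * s := by rw [frameC]; push_cast; ring

/-! ## §3a The coefficient letter of the covariant tent interpolant -/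

/-- THE TENT COEFFICIENT CONSTANT: `ktC = 8d² + 16·(136(d+1)(d+4) + 9d²)²`. [folklore] -/
def ktC (d : ℕ) : ℝ := 8 * (d : ℝ) ^ 2 + 16 * (136 * (((d : ℝ) + 1) * ((d : ℝ) + 4)) + 9 * (d : ℝ) ^ 2) ^ 2

/-- `0 ≤ ktC`. [folklore] -/
theorem ktC_nonneg (d : ℕ) : 0 ≤ ktC d := by unfold ktC; positivity

omit [Fintype n] [DecidableEq n] in
/-- **THE COEFFICIENT LETTER** (`L ≥ 2`, `LevelSmall`, regime `(L^{k+1})²x ≤ 1`): with `δ = 8·loopRad(x_k)` and `M = L^{k+1}`,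
`(8(dMx)² + (16∕M²)(δ + 9d²M²x)²)·M² ≤ ktC(d)`. [folklore] -/
theorem kt_mul_sq_le {L : ℕ} (hL : 2 ≤ L) (k : ℕ) {x : ℝ} (hx : 0 ≤ x) (hs : LevelSmall d L k x) {M : ℕ} (hMr : (M : ℝ) = (L : ℝ) ^ (k + 1))
    (hε : ((L : ℝ) ^ (k + 1)) ^ 2 * x ≤ 1) :
    (8 * ((d : ℝ) * M * x) ^ 2 + (16 / (M : ℝ) ^ 2) * (8 * loopRad d L ((prop1Radius d L)^[k] x) + 9 * (d : ℝ) ^ 2 * (M : ℝ) ^ 2 * x) ^ 2)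
        * (M : ℝ) ^ 2 ≤ ktC d := by
  have hM0 : (0 : ℝ) < (M : ℝ) := by rw [hMr]; exact pow_pos (by exact_mod_cast (show 0 < L by omega)) _
  have hMne : (M : ℝ) ≠ 0 := hM0.ne'
  obtain ⟨δ, hδ⟩ : ∃ δ : ℝ, δ = 8 * loopRad d L ((prop1Radius d L)^[k] x) := ⟨_, rfl⟩
  obtain ⟨ε, hεdef⟩ : ∃ ε : ℝ, ε = ((L : ℝ) ^ (k + 1)) ^ 2 * x := ⟨_, rfl⟩
  rw [← hδ]
  have hε0 : 0 ≤ ε := by rw [hεdef]; positivity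
  have hε1 : ε ≤ 1 := by rw [hεdef]; exact hε
  have hδle : δ ≤ 136 * (((d : ℝ) + 1) * ((d : ℝ) + 4)) * ε := by
    have hlr := loopRad_iterate_le_of_levelSmall (d := d) hL k hx hs
    rw [hδ, hεdef]; linarith
  have hδ0 : 0 ≤ δ := by
    rw [hδ]; unfold loopRad; have := NE3CovariantLineSumsError.iterate_prop1Radius_nonneg (d := d) (L := L) k hx; positivity
  have hMx : (M : ℝ) ^ 2 * x = ε := by rw [hεdef, hMr]
  have hA : (8 * ((d : ℝ) * M * x) ^ 2 + (16 / (M : ℝ) ^ 2) * (δ + 9 * (d : ℝ) ^ 2 * (M : ℝ) ^ 2 * x) ^ 2) * (M : ℝ) ^ 2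
      = 8 * (d : ℝ) ^ 2 * ε ^ 2 + 16 * (δ + 9 * (d : ℝ) ^ 2 * ε) ^ 2 := by
    rw [← hMx]; field_simp
  have hin : δ + 9 * (d : ℝ) ^ 2 * ε ≤ (136 * (((d : ℝ) + 1) * ((d : ℝ) + 4)) + 9 * (d : ℝ) ^ 2) * ε := by linarith
  have hin0 : 0 ≤ δ + 9 * (d : ℝ) ^ 2 * ε := by positivity
  have hsq : (δ + 9 * (d : ℝ) ^ 2 * ε) ^ 2 ≤ ((136 * (((d : ℝ) + 1) * ((d : ℝ) + 4)) + 9 * (d : ℝ) ^ 2) * ε) ^ 2 := pow_le_pow_left₀ hin0 hin 2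
  have hε2 : ε ^ 2 ≤ 1 := by nlinarith
  have hc0 : 0 ≤ (136 * (((d : ℝ) + 1) * ((d : ℝ) + 4)) + 9 * (d : ℝ) ^ 2) ^ 2 := by positivity
  have hd0 : 0 ≤ 8 * (d : ℝ) ^ 2 := by positivity
  rw [hA, ktC]
  have e1 := mul_le_mul_of_nonneg_left hε2 hd0
  have e2 := mul_le_mul_of_nonneg_left hε2 hc0
  nlinarith [e1, e2, hsq]

/-! ## §3 The covariant corrector is `O(sup|G| ∕ M)` on every bond -/

/-- THE CORRECTOR CONSTANT: `corrC = 2^{d+3} + 2^d·(8d² + 16·(136(d+1)(d+4) + 9d²)²)` (`≥ 1`). [folklore] -/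
def corrC (d : ℕ) : ℝ := (2 : ℝ) ^ (d + 3) + (2 : ℝ) ^ d * (8 * (d : ℝ) ^ 2 + 16 * (136 * (((d : ℝ) + 1) * ((d : ℝ) + 4)) + 9 * (d : ℝ) ^ 2) ^ 2)

/-- `1 ≤ corrC`. [folklore] -/
theorem one_le_corrC (d : ℕ) : 1 ≤ corrC d := by
  unfold corrC
  have h1 : (1 : ℝ) ≤ (2 : ℝ) ^ (d + 3) := one_le_pow₀ (by norm_num)
  have h2 : (0 : ℝ) ≤ (2 : ℝ) ^ d * (8 * (d : ℝ) ^ 2 + 16 * (136 * (((d : ℝ) + 1) * ((d : ℝ) + 4)) + 9 * (d : ℝ) ^ 2) ^ 2) := by positivity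
  linarith

/-- A gauge direction of a sup-bounded generator is at most twice the sup (unitary `U`). [folklore] -/
theorem norm_gaugeDir_le_two_mul {U : Site d → Fin d → (Matrix n n ℂ)ˣ} (hU : IsUnitaryCfg U) (m : Site d → Matrix n n ℂ) {g : ℝ}
    (hm : ∀ w, ‖m w‖ ≤ g) (w : Site d) (α : Fin d) : ‖gaugeDir U m w α‖ ≤ 2 * g := by
  unfold gaugeDir
  refine (norm_sub_le _ _).trans ?_
  rw [norm_Ad_of_unitary ((unitaryUnits _).inv_mem (hU w α))]
  linarith [hm w, hm (w + e α)]

/-- **THE COVARIANT CORRECTOR, POINTWISE** (`L ≥ 2`, class, regime letter `(L^{k+1})²·x ≤ 1`): for a generator with `‖m‖_∞ ≤ g`,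
`‖gaugeDir W (tinterpW M W m) (y,α)‖ ≤ corrC(d)∕M · g`, `M = L^{k+1}` — on EVERY bond, face-crossing or not. [folklore] -/
theorem norm_corrector_le [Nonempty n] {L : ℕ} (hL : 2 ≤ L) (k : ℕ) {W : Site d → Fin d → (Matrix n n ℂ)ˣ} {x : ℝ}
    (hWu : IsUnitaryCfg W) (hx : 0 ≤ x) (hs : LevelSmall d L k x) (hWx : SmallField W x) (hε : ((L : ℝ) ^ (k + 1)) ^ 2 * x ≤ 1)
    (m : Site d → Matrix n n ℂ) {g : ℝ} (hg0 : 0 ≤ g) (hm : ∀ w, ‖m w‖ ≤ g) (y : Site d) (α : Fin d) :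
    ‖gaugeDir W (tinterpW (L ^ (k + 1)) W m) y α‖ ≤ corrC d / (L : ℝ) ^ (k + 1) * g := by
  have hL1 : 1 ≤ L := by omega
  -- name the block size `M = L^{k+1}` once (an honest variable, no `set`)
  obtain ⟨M, hM⟩ : ∃ M : ℕ, M = L ^ (k + 1) := ⟨_, rfl⟩
  have hM1 : 1 ≤ M := by rw [hM]; exact Nat.one_le_pow _ _ (by omega)
  have hMr : ((M : ℕ) : ℝ) = (L : ℝ) ^ (k + 1) := by rw [hM]; push_cast; ring
  have hM0 : (0 : ℝ) < (M : ℝ) := by exact_mod_cast (show 0 < M by omega)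
  have hM2 : (0 : ℝ) < (M : ℝ) ^ 2 := by positivity
  have hMne : (M : ℝ) ≠ 0 := hM0.ne'
  rw [← hM, ← hMr]
  -- the coarse field `U = cavgIter (k+1) W` and its distance `δ` to the straight transports
  obtain ⟨hUu, -, -⟩ := cavgIter_unitary_small hL1 k hWu hx hs hWx
  obtain ⟨δ, hδ⟩ : ∃ δ : ℝ, δ = 8 * loopRad d L ((prop1Radius d L)^[k] x) := ⟨_, rfl⟩
  have hδb : ∀ (w : Site d) (β : Fin d), ‖((cavgIter L (k + 1) W w β : (Matrix n n ℂ)ˣ) : Matrix n n ℂ) - bseg M W w β‖ ≤ δ := fun w β => by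
    rw [hM, hδ]; exact norm_cavgIter_sub_bseg_le_top hL k hWu hx hs hWx w β
  -- the small coefficient: `Kt·M² ≤ C₀` from `δ ≤ 136(d+1)(d+4)·ε`, `ε = M²x ≤ 1`
  obtain ⟨ε, hεdef⟩ : ∃ ε : ℝ, ε = ((L : ℝ) ^ (k + 1)) ^ 2 * x := ⟨_, rfl⟩
  have hε0 : 0 ≤ ε := by rw [hεdef]; positivity
  have hε1 : ε ≤ 1 := by rw [hεdef]; exact hε
  have hδle : δ ≤ 136 * (((d : ℝ) + 1) * ((d : ℝ) + 4)) * ε := by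
    have hlr := loopRad_iterate_le_of_levelSmall (d := d) hL k hx hs
    rw [hδ, hεdef]; linarith
  have hδ0 : 0 ≤ δ := by
    rw [hδ]; unfold loopRad; have := NE3CovariantLineSumsError.iterate_prop1Radius_nonneg (d := d) (L := L) k hx; positivity
  obtain ⟨Kt, hKtdef⟩ : ∃ Kt : ℝ, Kt = 8 * ((d : ℝ) * M * x) ^ 2 + (16 / (M : ℝ) ^ 2) * (δ + 9 * (d : ℝ) ^ 2 * (M : ℝ) ^ 2 * x) ^ 2 := ⟨_, rfl⟩
  obtain ⟨C₀, hC₀⟩ : ∃ C₀ : ℝ, C₀ = 8 * (d : ℝ) ^ 2 + 16 * (136 * (((d : ℝ) + 1) * ((d : ℝ) + 4)) + 9 * (d : ℝ) ^ 2) ^ 2 := ⟨_, rfl⟩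
  have hC00 : 0 ≤ C₀ := by rw [hC₀]; positivity
  have hK0 : 0 ≤ Kt := by rw [hKtdef]; positivity
  have hKt : Kt * (M : ℝ) ^ 2 ≤ C₀ := by
    have hMx : (M : ℝ) ^ 2 * x = ε := by rw [hεdef, hMr]
    have hA : Kt * (M : ℝ) ^ 2 = 8 * (d : ℝ) ^ 2 * ε ^ 2 + 16 * (δ + 9 * (d : ℝ) ^ 2 * ε) ^ 2 := by
      rw [hKtdef, ← hMx]; field_simp
    have hin : δ + 9 * (d : ℝ) ^ 2 * ε ≤ (136 * (((d : ℝ) + 1) * ((d : ℝ) + 4)) + 9 * (d : ℝ) ^ 2) * ε := by linarith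
    have hin0 : 0 ≤ δ + 9 * (d : ℝ) ^ 2 * ε := by positivity
    have hsq : (δ + 9 * (d : ℝ) ^ 2 * ε) ^ 2 ≤ ((136 * (((d : ℝ) + 1) * ((d : ℝ) + 4)) + 9 * (d : ℝ) ^ 2) * ε) ^ 2 := pow_le_pow_left₀ hin0 hin 2
    have hε2 : ε ^ 2 ≤ 1 := by nlinarith
    have hc0 : 0 ≤ (136 * (((d : ℝ) + 1) * ((d : ℝ) + 4)) + 9 * (d : ℝ) ^ 2) ^ 2 := by positivity
    have hd0 : 0 ≤ 8 * (d : ℝ) ^ 2 := by positivity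
    rw [hA, hC₀]
    have e1 := mul_le_mul_of_nonneg_left hε2 hd0
    have e2 := mul_le_mul_of_nonneg_left hε2 hc0
    nlinarith [e1, e2, hsq]
  -- the cardinal constant `P = 2^d` and `corrC = 8P + P·C₀`
  obtain ⟨P, hP⟩ : ∃ P : ℝ, P = (2 : ℝ) ^ d := ⟨_, rfl⟩
  have hP1 : 1 ≤ P := by rw [hP]; exact one_le_pow₀ (by norm_num)
  have hP0 : 0 ≤ P := zero_le_one.trans hP1
  have hcorr : corrC d = 8 * P + P * C₀ := by rw [corrC, hP, hC₀, pow_add]; ring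
  have hnum1 : 16 * P + Kt * (M : ℝ) ^ 2 * P ≤ 16 * P + C₀ * P := by
    have := mul_le_mul_of_nonneg_right hKt hP0; linarith
  have hnum2 : 16 * P + C₀ * P ≤ corrC d * corrC d := by
    have hPP : P ≤ P * P := by nlinarith
    have hPC : P * C₀ ≤ P * P * C₀ := mul_le_mul_of_nonneg_right hPP hC00
    have hPPC : 0 ≤ P * P * C₀ := mul_nonneg (mul_nonneg hP0 hP0) hC00
    have hsqC : 0 ≤ P * C₀ * (P * C₀) := mul_self_nonneg _
    have hexp : corrC d * corrC d = 64 * (P * P) + 16 * (P * P * C₀) + P * C₀ * (P * C₀) := by rw [hcorr]; ring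
    rw [hexp]; linarith
  -- the energy identity of the covariant tent interpolant, with both sums bounded by the sup
  have hpt := normSq_gaugeDir_tinterpW_le hM1 hWu hUu hx hWx hδb m y α
  rw [← hKtdef] at hpt
  have h1 : ∑ T ∈ (Finset.univ.erase α).powerset, ‖gaugeDir (cavgIter L (k + 1) W) m (SmoothRefineBlocks.blk M y + SmoothRefineInterp.indic T) α‖ ^ 2
      ≤ P * (2 * g) ^ 2 := by
    calc _ ≤ ∑ _T ∈ (Finset.univ.erase α).powerset, (2 * g) ^ 2 := Finset.sum_le_sum fun T _ => by
            have h := norm_gaugeDir_le_two_mul hUu m hm (SmoothRefineBlocks.blk M y + SmoothRefineInterp.indic T) α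
            exact pow_le_pow_left₀ (norm_nonneg _) h 2
      _ ≤ P * (2 * g) ^ 2 := by
            rw [Finset.sum_const, nsmul_eq_mul, Finset.card_powerset, Finset.card_erase_of_mem (Finset.mem_univ α), Finset.card_univ,
              Fintype.card_fin, hP]
            refine mul_le_mul_of_nonneg_right ?_ (by positivity)
            exact_mod_cast Nat.pow_le_pow_right (by norm_num) (Nat.sub_le d 1)
  have h2 : ∑ T ∈ (Finset.univ : Finset (Fin d)).powerset, ‖m (SmoothRefineBlocks.blk M y + SmoothRefineInterp.indic T)‖ ^ 2 ≤ P * g ^ 2 := by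
    calc _ ≤ ∑ _T ∈ (Finset.univ : Finset (Fin d)).powerset, g ^ 2 :=
          Finset.sum_le_sum fun T _ => pow_le_pow_left₀ (norm_nonneg _) (hm _) 2
      _ = P * g ^ 2 := by rw [Finset.sum_const, nsmul_eq_mul, Finset.card_powerset, Finset.card_univ, Fintype.card_fin, hP]; push_cast; ring
  have hg2 : 0 ≤ g ^ 2 := by positivity
  have h4M : 0 ≤ 4 / (M : ℝ) ^ 2 := by positivity
  have hsq : ‖gaugeDir W (tinterpW M W m) y α‖ ^ 2 ≤ (corrC d / (M : ℝ) * g) ^ 2 := by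
    refine hpt.trans ?_
    calc (4 / (M : ℝ) ^ 2) * ∑ T ∈ (Finset.univ.erase α).powerset, ‖gaugeDir (cavgIter L (k + 1) W) m (SmoothRefineBlocks.blk M y + SmoothRefineInterp.indic T) α‖ ^ 2
          + Kt * ∑ T ∈ (Finset.univ : Finset (Fin d)).powerset, ‖m (SmoothRefineBlocks.blk M y + SmoothRefineInterp.indic T)‖ ^ 2
        ≤ (4 / (M : ℝ) ^ 2) * (P * (2 * g) ^ 2) + Kt * (P * g ^ 2) :=
          add_le_add (mul_le_mul_of_nonneg_left h1 h4M) (mul_le_mul_of_nonneg_left h2 hK0)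
      _ = ((16 * P + Kt * (M : ℝ) ^ 2 * P) / (M : ℝ) ^ 2) * g ^ 2 := by
          have e : (16 * P + Kt * (M : ℝ) ^ 2 * P) / (M : ℝ) ^ 2 = 16 * P / (M : ℝ) ^ 2 + Kt * P := by
            rw [add_div, mul_right_comm, mul_div_cancel_right₀ _ hM2.ne']
          rw [e]; ring
      _ ≤ ((16 * P + C₀ * P) / (M : ℝ) ^ 2) * g ^ 2 :=
          mul_le_mul_of_nonneg_right (div_le_div_of_nonneg_right hnum1 hM2.le) hg2
      _ ≤ (corrC d * corrC d / (M : ℝ) ^ 2) * g ^ 2 :=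
          mul_le_mul_of_nonneg_right (div_le_div_of_nonneg_right hnum2 hM2.le) hg2
      _ = (corrC d / (M : ℝ) * g) ^ 2 := by rw [mul_pow, div_pow, pow_two (corrC d)]
  have hb0 : 0 ≤ corrC d / (M : ℝ) * g := by have := one_le_corrC d; positivity
  have h := Real.sqrt_le_sqrt hsq
  rwa [Real.sqrt_sq (norm_nonneg _), Real.sqrt_sq hb0] at h

/-! ## §4 The sup letter (R5) of the exact right inverse -/

/-- THE SUP CONSTANT: `supC = liftC·(1 + corrC·frameC)`. [folklore] -/
def supC (d L : ℕ) : ℝ := liftC d * (1 + corrC d * frameC d L)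

/-- **THE SUP LETTER (R5) OF THE EXACT CURVED RIGHT INVERSE** (`L ≥ 2`, class, `θ = cruxC·(L^{k+1})²·x < 1`, regime `(L^{k+1})²·x ≤ 1`):
for a skew coarse field with `‖φ‖_∞ ≤ s`, at EVERY fine bond `‖rightInvW … φ (y,μ)‖ ≤ supC(d,L) ∕ (L^{k+1}·(1 − θ)) · s`. [folklore] -/
theorem norm_rightInvW_le [Nonempty n] {L : ℕ} (hL : 2 ≤ L) (k : ℕ) {W : Site d → Fin d → (Matrix n n ℂ)ˣ} {x : ℝ}
    (hWu : IsUnitaryCfg W) (hx : 0 ≤ x) (hs : LevelSmall d L k x) (hWx : SmallField W x) (N : ℕ) [NeZero N]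
    (hθ : cruxC d L * (((L : ℝ) ^ (k + 1)) ^ 2 * x) < 1) (hε : ((L : ℝ) ^ (k + 1)) ^ 2 * x ≤ 1)
    {φ : Site d → Fin d → Matrix n n ℂ} (hφ : IsSkewDir φ) {s : ℝ} (hs0 : 0 ≤ s) (hφs : ∀ (z : Site d) (κ : Fin d), ‖φ z κ‖ ≤ s)
    (y : Site d) (μ : Fin d) :
    ‖rightInvW hL k hWu hx hs hWx N hθ hφ y μ‖ ≤ supC d L / ((L : ℝ) ^ (k + 1) * (1 - cruxC d L * (((L : ℝ) ^ (k + 1)) ^ 2 * x))) * s := by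
  have hd : 1 ≤ d := μ.pos
  set M : ℕ := L ^ (k + 1) with hM
  have hM2 : 2 ≤ M := by
    rw [hM]; calc 2 ≤ L := hL
      _ = L ^ 1 := (pow_one L).symm
      _ ≤ L ^ (k + 1) := Nat.pow_le_pow_right (by omega) (by omega)
  have hMr : ((M : ℕ) : ℝ) = (L : ℝ) ^ (k + 1) := by rw [hM]; push_cast; ring
  have hM0 : (0 : ℝ) < (L : ℝ) ^ (k + 1) := by positivity
  set θ : ℝ := cruxC d L * (((L : ℝ) ^ (k + 1)) ^ 2 * x) with hθdef
  have h1θ : 0 < 1 - θ := by linarith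
  -- the solved coarse datum and its sup
  set ψ : ↥(skewSub d n N) := solveW hL k hWu hx hs hWx N hθ (resSkew N hφ) with hψ
  set Φ : Site d → Fin d → Matrix n n ℂ := extDir N (ψ : TDir d n N) with hΦ
  have hρ : ‖(resSkew N hφ : ↥(skewSub d n N))‖ ≤ s := by
    show ‖(resDir N φ : TDir d n N)‖ ≤ s
    exact (pi_norm_le_iff_of_nonneg hs0).mpr fun r => (pi_norm_le_iff_of_nonneg hs0).mpr fun κ => hφs _ _
  have hψn : ‖ψ‖ ≤ s / (1 - θ) := (norm_solveW_le hL k hWu hx hs hWx N hθ _).trans (div_le_div_of_nonneg_right hρ h1θ.le)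
  set s' : ℝ := s / (1 - θ) with hs'
  have hs'0 : 0 ≤ s' := by rw [hs']; positivity
  have hΦs : ∀ (z : Site d) (κ : Fin d), ‖Φ z κ‖ ≤ s' := fun z κ =>
    ((norm_le_pi_norm ((ψ : TDir d n N) (redN N z)) κ).trans (norm_le_pi_norm (ψ : TDir d n N) (redN N z))).trans hψn
  -- (i) the lift
  have hY : ∀ (y' : Site d) (μ' : Fin d), ‖covLift M W Φ y' μ'‖ ≤ liftC d / M * s' := fun y' μ' => by
    rw [norm_covLift_eq hWu]
    refine (norm_smoothLift_le hM2 hd Φ y' μ').trans ?_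
    rw [liftC]; exact mul_le_mul_of_nonneg_left (hΦs _ _) (by positivity)
  have hlift0 : 0 ≤ liftC d / M * s' := by have := liftC_nonneg d; positivity
  -- (ii) the frames
  have hG : ∀ w, ‖(fun z => -frameGen L k W Φ z) w‖ ≤ frameC d L * liftC d * s' := fun w => by
    simp only [norm_neg, frameGen]
    refine (norm_framePotW_le_of_sup hL k hWu hx hs hWx (covLift M W Φ) hlift0 hY w).trans (le_of_eq ?_)
    rw [← hMr]; field_simp
  have hg0 : 0 ≤ frameC d L * liftC d * s' := by have := liftC_nonneg d; unfold frameC; positivity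
  -- (iii) the corrector
  have hcorr := norm_corrector_le hL k hWu hx hs hWx hε (fun z => -frameGen L k W Φ z) hg0 hG y μ
  -- assemble
  have hval : rightInvW hL k hWu hx hs hWx N hθ hφ y μ = covLift M W Φ y μ + gaugeDir W (tinterpW M W (fun z => -frameGen L k W Φ z)) y μ := rfl
  rw [hval]
  refine (norm_add_le _ _).trans ?_
  have hsum : liftC d / M * s' + corrC d / (L : ℝ) ^ (k + 1) * (frameC d L * liftC d * s') = supC d L / ((L : ℝ) ^ (k + 1) * (1 - θ)) * s := by
    rw [hMr, supC, hs']; field_simp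
  rw [← hsum]
  exact add_le_add (hY y μ) hcorr

end

end Summit.QuantumFields.BalabanUV.T4Continuum.NE3RightInverseSupLetters
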